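import Summits.AtomisticToContinuum.BoseEinsteinCondensation.Theorems.BECGroundStateSOSPeriodicIRBoundFsumDCAdjoint
import Summits.AtomisticToContinuum.BoseEinsteinCondensation.Theorems.BECGroundStateSOSPeriodicIRBoundFsumExcitedPairs
import Summits.AtomisticToContinuum.BoseEinsteinCondensation.Theorems.BECGroundStateSOSPeriodicIRBoundFsumConePhaseUp
import Summits.AtomisticToContinuum.BoseEinsteinCondensation.Theorems.BECGroundStateSOSPeriodicIRBoundFsumDichotomy
import Literature.MathematicalPhysics.QuantumManyBody.TorusFockLayer
import HarnessLib

/-!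
# Crux `RichardsonAnchorBEC` (stmt-AtomisticToContinuum-14805), route `BECRichardsonGaudin`, line `registered` —
# stub `stub_bandKineticLower`: band / kinetic bookkeeping

For a periodic trial state `Φ` of `N = n + 2` bosons on the torus of side `L > 0`, a band cut-off `M` and a
coupling `γ ≥ 0`, writing `a_k := modeAn L (planeWaveMode L k)` and `B_M = momentumBand M`, we prove the three
bookkeeping facts consumed by the lower-bound assembly of the anchor functional
`E(Φ) = periodicEnergy 0 Φ + ofReal κ · (N − n₀) + ofReal (γ/L⁹ · N(N−1)/2) · ∫ |∫∫ conj(w) Φ|²`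
(`w = bandKernel L M`):

* (a) `Σ_{k ∈ B_M ∖ {0}} |k|² ‖a_k Φ‖² ≤ periodicEnergy 0 Φ` — a finite partial sum of the kinetic Parseval
  identity `T = Σ_k |k|² ‖a_k Φ‖²` (`periodicEnergy_zero_eq_tsum_modeAn`);
* (b) `Σ_{k ∈ B_M ∖ {0}} ‖a_k Φ‖² ≤ N − n₀` — a finite partial sum of the depletion identity
  `N − n₀ = Σ_{k ≠ 0} ‖a_k Φ‖²` (`natCast_sub_condensateOccupation_eq_tsum_modeAn`);
* (c) the pair-functional dictionary `ofReal (γ/L⁹ · N(N−1)/2) · ∫ |∫∫ conj(w) Φ|² = ofReal (γ/(2L³)) · ‖Σ_{k ∈ B_M} a_{-k} a_k Φ‖²`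
  (`lintegral_sum_modeAn_modeAn_sq` and the real identity `γ/(2L³) · N(N−1)/L⁶ = γ/L⁹ · N(N−1)/2`).

The tree dictionary lemmas are stated with the indicator plane wave `planeWave L k`; they are converted to the
smooth mode `planeWaveMode L k` by `modeAn_planeWave_eq`.
-/

noncomputable section

open MeasureTheory Filter
open scoped ENNReal NNReal ComplexConjugate BigOperators

namespace Summit.AtomisticToContinuum.BoseEinsteinCondensation.Cruxes.RichardsonAnchorBEC.Birth

open Literature.MathematicalPhysics.QuantumManyBody.BoseGas
open Summit.AtomisticToContinuum.BoseEinsteinCondensation.Cruxes.PeriodicIRBound.LinearPhFloorWagner.WF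

/-- **Band / kinetic bookkeeping for the Richardson anchor.** For `L > 0`, `γ ≥ 0`, a band cut-off `M` and a
periodic trial state `Φ` of `n + 2` bosons, with `a_k = modeAn L (planeWaveMode L k)`:
(a) `Σ_{k ∈ B_M ∖ {0}} |k|² ‖a_k Φ‖² ≤ periodicEnergy 0 Φ`;
(b) `Σ_{k ∈ B_M ∖ {0}} ‖a_k Φ‖² ≤ N − n₀`;
(c) `ofReal (γ/L⁹ · N(N−1)/2) · ∫_{Λ^{N-2}} |∫∫ conj(bandKernel) Φ|² = ofReal (γ/(2L³)) · ‖Σ_{k ∈ B_M} a_{-k} a_k Φ‖²`.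
[cite: LSSY2005, App. A (A.6), (A.10), (A.13)] -/
theorem stub_bandKineticLower :
    ∀ (L γ : ℝ) (n M : ℕ), 0 < L → 0 ≤ γ → ∀ Φ : PeriodicTrialState (n + 2) L,
      (∑ k ∈ (momentumBand M).erase 0, ENNReal.ofReal (‖waveVector L k‖ ^ 2) *
          normSq L (modeAn L (planeWaveMode L k) Φ.ψ) ≤ periodicEnergy 0 Φ) ∧
      (∑ k ∈ (momentumBand M).erase 0, normSq L (modeAn L (planeWaveMode L k) Φ.ψ) ≤
          ((n + 2 : ℕ) : ℝ≥0∞) - condensateOccupation (n + 2) L Φ.ψ) ∧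
      ENNReal.ofReal (γ / L ^ 9 * (((n + 2 : ℕ) : ℝ) * ((n + 2 : ℕ) - 1) / 2)) *
          (∫⁻ Y in cellN n L, (‖∫ x in cell L, ∫ y in cell L,
            (starRingEnd ℂ) (bandKernel L M x y) * Φ.ψ (Matrix.vecCons x (Matrix.vecCons y Y))‖₊ : ℝ≥0∞) ^ 2) =
        ENNReal.ofReal (γ / (2 * L ^ 3)) * normSq L (fun Y => ∑ k ∈ momentumBand M,
            modeAn L (planeWaveMode L (-k)) (modeAn L (planeWaveMode L k) Φ.ψ) Y) := by
  intro L γ n M hL hγ Φ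
  refine ⟨?_, ?_, ?_⟩
  · -- (a): a finite partial sum of `T = Σ_k |k|² ‖a_k Φ‖²`
    calc ∑ k ∈ (momentumBand M).erase 0, ENNReal.ofReal (‖waveVector L k‖ ^ 2) *
          normSq L (modeAn L (planeWaveMode L k) Φ.ψ)
        = ∑ k ∈ (momentumBand M).erase 0, ENNReal.ofReal (‖waveVector L k‖ ^ 2) *
            ∫⁻ Y in cellN (n + 1) L, (‖modeAn L (planeWave L k) Φ.ψ Y‖₊ : ℝ≥0∞) ^ 2 := by
          simp only [modeAn_planeWave_eq]
          rfl
      _ ≤ ∑' k, ENNReal.ofReal (‖waveVector L k‖ ^ 2) *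
            ∫⁻ Y in cellN (n + 1) L, (‖modeAn L (planeWave L k) Φ.ψ Y‖₊ : ℝ≥0∞) ^ 2 :=
          ENNReal.sum_le_tsum _
      _ = periodicEnergy 0 Φ := (periodicEnergy_zero_eq_tsum_modeAn hL Φ).symm
  · -- (b): a finite partial sum of `N − n₀ = Σ_{k ≠ 0} ‖a_k Φ‖²`
    calc ∑ k ∈ (momentumBand M).erase 0, normSq L (modeAn L (planeWaveMode L k) Φ.ψ)
        = ∑ k ∈ (momentumBand M).erase 0, (if k = 0 then 0 else
            ∫⁻ Y in cellN (n + 1) L, (‖modeAn L (planeWave L k) Φ.ψ Y‖₊ : ℝ≥0∞) ^ 2) := by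
          refine Finset.sum_congr rfl fun k hk => ?_
          rw [if_neg (Finset.ne_of_mem_erase hk), modeAn_planeWave_eq]
          rfl
      _ ≤ ∑' k, (if k = 0 then 0 else
            ∫⁻ Y in cellN (n + 1) L, (‖modeAn L (planeWave L k) Φ.ψ Y‖₊ : ℝ≥0∞) ^ 2) :=
          ENNReal.sum_le_tsum _
      _ = ((n + 2 : ℕ) : ℝ≥0∞) - condensateOccupation (n + 2) L Φ.ψ :=
          (natCast_sub_condensateOccupation_eq_tsum_modeAn hL Φ).symm
  · -- (c): the pair-functional dictionary
    have hΨ : Continuous Φ.ψ := Φ.contDiff.continuous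
    have h := lintegral_sum_modeAn_modeAn_sq hL M hΨ
    simp only [modeAn_planeWave_eq] at h
    have h9 : γ / L ^ 9 * (((n + 2 : ℕ) : ℝ) * ((n + 2 : ℕ) - 1) / 2) =
        γ / (2 * L ^ 3) * (((n + 2 : ℕ) : ℝ) * ((n + 2 : ℕ) - 1) / L ^ 6) := by
      ring
    have h0 : 0 ≤ γ / (2 * L ^ 3) := by positivity
    rw [h9, ENNReal.ofReal_mul h0, mul_assoc, ← h]
    rfl

end Summit.AtomisticToContinuum.BoseEinsteinCondensation.Cruxes.RichardsonAnchorBEC.Birth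

end
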